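/-
Copyright (c) 2026 the pub-hodgecm-mathlib formalisation cell (harness21).  Prover seat hodgecm-mathlib-K2Liu-p12 (g7), Track B «K2-LIT»,
#184♮ = hLiu418 = `stmt-HodgeConjecture-24832`; #42S block D, row D-2, (σ-A) mini-road ((σ-A) road desk WORDS #51∕#53∕#56, desk (g4) WORD #1 (2):
brick (B2-coord) FILE B, part 1 of 2 «THE GRAPH READING, POINT LAYER — COORDINATES»).  THEOREMS ONLY (no `def`, no `instance`, no `notation`,
no named-fact hypothesis, no `sorry`).
-/
import Summits.HodgeConjecture.HodgeConjecture.Theorems.K2LiuConeGraphReadingOperator       -- ★ p865151 (B1)+(B2-read): `inv_mulVec_eq_fst_apply_of_eq_transportSp_levi`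
import Summits.HodgeConjecture.HodgeConjecture.Theorems.K2LiuNormalisedCayleyReading          -- ★ p865154 (B2-coord) FILE B′: `transportSp_levi_mul_cayley_symm_apply` (+ ★ (C3-c))
import Summits.HodgeConjecture.HodgeConjecture.Theorems.K2LiuQuadraticCoordinateBlockAction   -- ★ p865058 (B2-coord) FILE A: `reindex_kronecker_one_mulVec_slot`
import Summits.HodgeConjecture.HodgeConjecture.Theorems.K2LiuLocalSWTensorAdaptedBlocks        -- ★ F5c-A: `matA_tensorEmbLoc`, `blk_reindex_kronecker`
import HarnessLib

/-!
# Crux `HLiu418`, #42S block D row D-2, (σ-A) brick (B2-coord) FILE B (part 1 of 2) `K2LiuConeGraphReadingPointCoords`: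
# THE `E ⊗ F_v`-COORDINATES OF THE TWO-BLOCK INTEGRATION POINT AT THE NORMALISED IMPLEMENTER PAIR, AND THE SLOT ACTION OF `G ⊗ 1`

Cell `hodgecm-mathlib`, crux item hLiu418 = `stmt-HodgeConjecture-24832`; lane `--supports stmt-HodgeConjecture-24832 --as helper` (count-neutral helper).

WHY.  ★ p865151 (B1) `K2LiuConeGraphReadingOperator.exists_levi_letter_toOp_boxLoc_localSplitting_tensorEmbLoc_apply` reads the conjugate of a small
Siegel–LEVI element `p₀ ⊗ 1` through the implementer of record `E′ := π(frameMp_{PD} j̃(p₁, p₂))` as `c · |det B|^{-1/2} · Ψ(P̂D⁻¹ (B⁻¹ (P̂D u)))` with an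
∃-discharged Levi letter `B` (`E′ ∘ ι(p₀ ⊗ 1) ∘ E′⁻¹ = transportSp 𝕋 (m(B))`).  K2Liu-p08's (an-3c) §3b telescope (★ p864562 `coneWord_of_stageLetters`, slot
`hL2`) evaluates that at the integration point `u = P̂D (x₁ ⊔ 0)` and needs `P̂D⁻¹ (B⁻¹ (P̂D (x₁ ⊔ 0)))` IN THE BOX COORDINATES of the Schrödinger model —
the sequel `K2LiuConeGraphReadingPoint` (part 2).  THIS FILE is the coordinate layer underneath it, at the NORMALISED implementer pair of record (desk
ruling (N), ★ p865154 FILE B′: `π(p̂ᵢ) = transportSp 𝕋ᵢ (m(Qᵢ)·κᵢ)`, `Qᵢ⁻¹ = 2 ⊕ Tᵢ`, `κᵢ` the Cayley matrix):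
* §0 algebra: the `Δ`-adapted blocks of the INVERSE of a Siegel–Levi element (**`blkB_blkD_matA_inv`**: `blkB (matA p⁻¹) = 0`, `blkD (matA p⁻¹) = G` when
  `blkB (matA p) = 0`, `blkD (matA p) · G = 1`), and `(Q ⊕ Q) · adblV b = adblV (Q b)`;
* §1 `E ⊗ F_v`-coordinates (generic doubled datum): **`eD_symm_frameW_pd`** (`e_D⁻¹ ∘ frameW_{PD} = (P̂ ⊕ P̂) ∘ e_D⁻¹`), **`eD_symm_glue_antidiag`** (the
  block anti-diagonal point `((z¹ ⊔ −z¹) ⊔ (z′¹ ⊔ −z′¹), (z² ⊔ −z²) ⊔ (z′² ⊔ −z′²))` is `adblV` of the plain quadratic coordinates `ι z_{inl} + ι z_{inr}·δ̂`,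
  glued along `finSumFinEquiv`), **`coe_iotaD_symm_eD`** (`ι(g)⁻¹ (e_D u) = e_D (matA g⁻¹ · u)`, ★ `eD_matA_mulVec` read backwards), and
  **`matA_tensorEmbLoc_inv_mulVec_adblV`** (`matA (p₀ ⊗ 1)⁻¹ · adblV b = adblV (reindex epsV (G ⊗ₖ 1) · b)`, ★ F5c-A);
* §2 **`symm_apply_frameLin_glue`** — ★ (C3-c) `toLin_inv_frameMp_boxLoc_apply` for a TWO-block point: `E′⁻¹ (P̂D (z₁ ⊔ z₂), 0) =
  frameW_{PD} (u₁.1 ⊔ u₂.1, u₁.2 ⊔ u₂.2)`, `uᵢ = π(pᵢ)⁻¹ (zᵢ, 0)` (any implementer pair);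
* §3 **`symm_apply_frameLin_glue_eq_eD_adblV`** — at the normalised pair `E′⁻¹ (P̂D (z₁ ⊔ z₂), 0) = e_D (adblV ((Z z₁ ⊔ Z z₂) ∘ σ))`,
  `Z z l := ι z_{e₂(inl l)} + ι z_{e₂(inr l)}·δ̂` (★ B′ + §1 + the block permutation `σ` of ★ (C2b′): `P = σ.toPEquiv.toMatrix`); and
  **`reindex_kronecker_one_mulVec_glue_comp`** — `reindex epsV (G ⊗ₖ 1)` sends `(Z x₁ ⊔ Z 0) ∘ σ` (supported on slot `i₀`) to `(Z y₁ ⊔ Z y₂) ∘ σ` whenever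
  `Z y₁ = G i₀ i₀ · Z x₁`, `Z y₂ = G i₁ i₀ · Z x₁` (★ p865058 `reindex_kronecker_one_mulVec_slot`).
[cite: Kudla1994, §2, §3 Thm. 3.1] [cite: MoeglinVignerasWaldspurger1987, Chap. 2 II.1 Rem. (6), II.2, II.6] [cite: HarrisKudlaSweet1996, §1 (1.11)–(1.12)] [cite: Weil1964, n° 6, n° 34]
HONEST LABEL.  Count-neutral helper; it retires nothing by itself: `HC_CM` is proved only modulo the 7 printed citations (2 remaining named inputs:
hLiu418 = `stmt-HodgeConjecture-24832`, h413 = `stmt-HodgeConjecture-24833`) until rung 0 closes.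

## References
* [Kudla1994] S. S. Kudla, *Splitting metaplectic covers of dual reductive pairs*, Israel J. Math. 87 (1994), §2, §3 Thm. 3.1.
* [MoeglinVignerasWaldspurger1987] C. Mœglin, M.-F. Vignéras, J.-L. Waldspurger, LNM 1291 (1987), Chap. 2 II.1 Rem. (6), II.2, II.6.
* [HarrisKudlaSweet1996] M. Harris, S. Kudla, W. J. Sweet, J. Amer. Math. Soc. 9 (1996), §1 (1.11)–(1.12).
* [Weil1964] A. Weil, Acta Math. 111 (1964), n° 6, n° 34.
-/

set_option autoImplicit false
set_option linter.dupNamespace false -- the mandated namespace repeats `HodgeConjecture.HodgeConjecture`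

noncomputable section

open scoped Matrix Kronecker
open NumberField IsDedekindDomain Matrix
open Literature.RepresentationTheory.HeisenbergGroup Literature.RepresentationTheory.HeisenbergGroup.SymplecticMatrix
open Literature.NumberTheory.Automorphic Literature.NumberTheory.Automorphic.UnitaryGroup Literature.NumberTheory.Weil1964
open Literature.NumberTheory.GelbartRogawski1991 Literature.NumberTheory.GelbartRogawski1991.GRConstruction
open Literature.NumberTheory.GelbartRogawski1991.AdaptedBlocks
open Literature.NumberTheory.GelbartRogawski1991.UnitaryDualPair
open Literature.NumberTheory.GelbartRogawski1991.UnitaryDualPair.LocalSplitting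
open Literature.NumberTheory.GelbartRogawski1991.UnitaryDualPair.LocalSplitting.FrameTransport
open Literature.NumberTheory.GelbartRogawski1991.UnitaryDualPair.LocalSplitting.DoubledBlock
open Literature.NumberTheory.K2Lit.SiegelDoubled
open Summit.HodgeConjecture.HodgeConjecture.Cruxes.HLiu418.K2LiuLocalSWSectionDefs
open Summit.HodgeConjecture.HodgeConjecture.Cruxes.HLiu418.K2LiuLocalSWTensorAdaptedBlocks

namespace Summit.HodgeConjecture.HodgeConjecture.Cruxes.HLiu418.K2LiuConeGraphReadingPointCoords

/-! ## §0 Algebra: the adapted blocks of the inverse of a Siegel–Levi element; `(Q ⊕ Q) · adblV b` -/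

section Algebra

/-- `(Q ⊕ Q) · (b, −b) = (Q b, −Q b)`: a block-scalar matrix preserves anti-diagonal vectors. [cite: HarrisKudlaSweet1996, §1 (1.11)] -/
theorem fromBlocks_diag_mulVec_adblV {R : Type*} [CommRing R] {ι : Type*} [Fintype ι] (Q : Matrix ι ι R) (b : ι → R) :
    Matrix.fromBlocks Q 0 0 Q *ᵥ adblV b = adblV (Q *ᵥ b) := by
  funext k
  rcases k with i | i <;>
    simp only [adblV, Matrix.fromBlocks_mulVec, Sum.elim_comp_inl, Sum.elim_comp_inr, Matrix.zero_mulVec, add_zero, zero_add, Sum.elim_inl,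
      Sum.elim_inr, Matrix.mulVec_neg, neg_zero]

variable (F : Type) [Field F] [NumberField F] (E : Type) [Field E] [NumberField E] [Algebra F E] (c : E ≃ₐ[F] E)
  (v : HeightOneSpectrum (𝓞 F)) (n : ℕ) {JD : Matrix (Fin (n + n)) (Fin (n + n)) E}

/-- **THE INVERSE OF A SIEGEL–LEVI ELEMENT IN ADAPTED BLOCKS**: if `B(p) = 0` and `D(p) · G = 1` then `B(p⁻¹) = 0` and `D(p⁻¹) = G` (★ `blkB_mul`, `blkD_mul` on
`matA p⁻¹ · matA p = 1`). [cite: Kudla1994, §3] [cite: MoeglinVignerasWaldspurger1987, Chap. 2 II.2] -/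
theorem blkB_blkD_matA_inv {p : UnitaryGroup.localPi E c (n + n) JD v} {G : Matrix (Fin n) (Fin n) (LocalRing E v)}
    (hB : blkB (matA F E c v n p) = 0) (hG : blkD (matA F E c v n p) * G = 1) :
    blkB (matA F E c v n p⁻¹) = 0 ∧ blkD (matA F E c v n p⁻¹) = G := by
  have h1 : matA F E c v n p⁻¹ * matA F E c v n p = 1 := by rw [matA_mul, inv_mul_cancel, matA_one]
  have hBi : blkB (matA F E c v n p⁻¹) * blkD (matA F E c v n p) = 0 := by
    have h := blkB_mul (matA F E c v n p⁻¹) (matA F E c v n p)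
    rw [h1, blkB_one, hB, Matrix.mul_zero, zero_add] at h
    exact h.symm
  have hDi : blkD (matA F E c v n p⁻¹) * blkD (matA F E c v n p) = 1 := by
    have h := blkD_mul (matA F E c v n p⁻¹) (matA F E c v n p)
    rw [h1, blkD_one, hB, Matrix.mul_zero, zero_add] at h
    exact h.symm
  refine ⟨?_, ?_⟩
  · calc blkB (matA F E c v n p⁻¹) = blkB (matA F E c v n p⁻¹) * (blkD (matA F E c v n p) * G) := by rw [hG, Matrix.mul_one]
      _ = 0 := by rw [← Matrix.mul_assoc, hBi, Matrix.zero_mul]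
  · calc blkD (matA F E c v n p⁻¹) = blkD (matA F E c v n p⁻¹) * (blkD (matA F E c v n p) * G) := by rw [hG, Matrix.mul_one]
      _ = G := by rw [← Matrix.mul_assoc, hDi, Matrix.one_mul]

end Algebra

/-! ## §1 `E ⊗ F_v`-coordinates: the doubled frame, block anti-diagonal points, `ι(g)⁻¹`, and `(p₀ ⊗ 1)⁻¹` on anti-diagonal vectors -/

section Generic

variable (F : Type) [Field F] [NumberField F] (E : Type) [Field E] [NumberField E] [Algebra F E] [Algebra.IsQuadraticExtension F E]
  (c : E ≃ₐ[F] E) {δ : E} (hcδ : c δ = -δ) (hδ : δ ≠ 0) {d : F} (hd : δ * δ = algebraMap F E d)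
  (v : HeightOneSpectrum (𝓞 F))

/-- **THE DOUBLED FRAME IN `E ⊗ F_v`-COORDINATES**: `e_D⁻¹ (frameW_{PD} w) = (P̂ ⊕ P̂) · e_D⁻¹ w` for `PD = P ⊕ P` along `e₂` (`P̂ = P` read over `E ⊗ F_v`; ★
`resL_resR_frameLin_pd`: the `e₂`-halves of `PD·u` are `P·u_L`, `P·u_R`). [cite: Weil1964, n° 34] [cite: HarrisKudlaSweet1996, §1 (1.11)] -/
theorem eD_symm_frameW_pd (n : ℕ) (P : GL (Fin n) F) {PD : GL (Fin (n + n)) F}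
    (hPD : PD = UnitaryGroup.reindexGL (e₂ n) (UnitaryGroup.blockDiagGL (P, P)))
    (w : (Fin (n + n) → v.adicCompletion F) × (Fin (n + n) → v.adicCompletion F)) :
    (eD F E c hcδ hδ hd v n).symm (frameW F v (n + n) PD w) =
      Matrix.fromBlocks ((P : Matrix (Fin n) (Fin n) F).map ((UnitaryGroup.toLocalRing E v).comp (algebraMap F (v.adicCompletion F)))) 0 0
          ((P : Matrix (Fin n) (Fin n) F).map ((UnitaryGroup.toLocalRing E v).comp (algebraMap F (v.adicCompletion F)))) *ᵥ
        (eD F E c hcδ hδ hd v n).symm w := by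
  have h1 := resL_resR_frameLin_pd F v n P hPD w.1
  have h2 := resL_resR_frameLin_pd F v n P hPD w.2
  -- the summands of `P̂ · (e_D⁻¹ w)` distribute over the quadratic coordinates
  have key : ∀ (s : Fin n → Fin n ⊕ Fin n) (i : Fin n),
      UnitaryGroup.toLocalRing E v (∑ j, algebraMap F (v.adicCompletion F) (P i j) * w.1 (e₂ n (s j))) +
          UnitaryGroup.toLocalRing E v (∑ j, algebraMap F (v.adicCompletion F) (P i j) * w.2 (e₂ n (s j))) * algebraMap E (LocalRing E v) δ =
        ∑ j, ((P : Matrix (Fin n) (Fin n) F).map ((UnitaryGroup.toLocalRing E v).comp (algebraMap F (v.adicCompletion F)))) i j *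
          (eD F E c hcδ hδ hd v n).symm w (s j) := by
    intro s i
    simp only [map_sum, map_mul, Matrix.map_apply, RingHom.comp_apply,
      K2LiuTensorMiddleCellPointReading.eD_symm_apply F E c hcδ hδ hd v n, mul_add, Finset.sum_add_distrib, Finset.sum_mul, mul_assoc]
  funext s
  rcases s with i | i
  · have a1 : (frameW F v (n + n) PD w).1 (e₂ n (Sum.inl i)) = ∑ j, algebraMap F (v.adicCompletion F) (P i j) * w.1 (e₂ n (Sum.inl j)) := by
      have h := congrFun h1.1 i
      simp only [resL, frameLin_apply, Matrix.mulVec, dotProduct, Matrix.map_apply] at h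
      rw [frameW_apply]; exact h
    have a3 : (frameW F v (n + n) PD w).2 (e₂ n (Sum.inl i)) = ∑ j, algebraMap F (v.adicCompletion F) (P i j) * w.2 (e₂ n (Sum.inl j)) := by
      have h := congrFun h2.1 i
      simp only [resL, frameLin_apply, Matrix.mulVec, dotProduct, Matrix.map_apply] at h
      rw [frameW_apply]; exact h
    rw [K2LiuTensorMiddleCellPointReading.eD_symm_apply, a1, a3, Matrix.fromBlocks_mulVec, Sum.elim_inl, Matrix.zero_mulVec, add_zero,
      Matrix.mulVec, dotProduct]
    exact key Sum.inl i
  · have a2 : (frameW F v (n + n) PD w).1 (e₂ n (Sum.inr i)) = ∑ j, algebraMap F (v.adicCompletion F) (P i j) * w.1 (e₂ n (Sum.inr j)) := by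
      have h := congrFun h1.2 i
      simp only [resR, frameLin_apply, Matrix.mulVec, dotProduct, Matrix.map_apply] at h
      rw [frameW_apply]; exact h
    have a4 : (frameW F v (n + n) PD w).2 (e₂ n (Sum.inr i)) = ∑ j, algebraMap F (v.adicCompletion F) (P i j) * w.2 (e₂ n (Sum.inr j)) := by
      have h := congrFun h2.2 i
      simp only [resR, frameLin_apply, Matrix.mulVec, dotProduct, Matrix.map_apply] at h
      rw [frameW_apply]; exact h
    rw [K2LiuTensorMiddleCellPointReading.eD_symm_apply, a2, a4, Matrix.fromBlocks_mulVec, Sum.elim_inr, Matrix.zero_mulVec, zero_add,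
      Matrix.mulVec, dotProduct]
    exact key Sum.inr i

/-- **BLOCK ANTI-DIAGONAL POINTS IN `E ⊗ F_v`-COORDINATES**: the two-block point whose `𝕎^𝔻_{Tᵢ}`-components are the anti-diagonal pairs
`((zᵢ¹ ⊔ −zᵢ¹), (zᵢ² ⊔ −zᵢ²))` (`zᵢ = zᵢ¹ ⊔ zᵢ²` along `e₂`; ★ B′ `transportSp_levi_mul_cayley_symm_apply`'s output shape), glued along Kudla's `blkIdx`, is
`e_D (adblV (Z z₁ ⊔ Z z₂))` with the PLAIN quadratic coordinates `Z z l = ι z_{e₂(inl l)} + ι z_{e₂(inr l)} · δ̂` glued along `finSumFinEquiv`.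
[cite: HarrisKudlaSweet1996, §1 (1.11)] [cite: Kudla1994, §2] -/
theorem eD_symm_glue_antidiag (n₁ n₂ : ℕ) (z₁ : Fin (n₁ + n₁) → v.adicCompletion F) (z₂ : Fin (n₂ + n₂) → v.adicCompletion F) :
    (eD F E c hcδ hδ hd v (n₁ + n₂)).symm
        (glue (blkIdx n₁ n₂) ((Sum.elim (fun i => z₁ (e₂ n₁ (Sum.inl i))) (fun i => -z₁ (e₂ n₁ (Sum.inl i)))) ∘ (e₂ n₁).symm)
            ((Sum.elim (fun i => z₂ (e₂ n₂ (Sum.inl i))) (fun i => -z₂ (e₂ n₂ (Sum.inl i)))) ∘ (e₂ n₂).symm),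
          glue (blkIdx n₁ n₂) ((Sum.elim (fun i => z₁ (e₂ n₁ (Sum.inr i))) (fun i => -z₁ (e₂ n₁ (Sum.inr i)))) ∘ (e₂ n₁).symm)
            ((Sum.elim (fun i => z₂ (e₂ n₂ (Sum.inr i))) (fun i => -z₂ (e₂ n₂ (Sum.inr i)))) ∘ (e₂ n₂).symm)) =
      adblV (glue finSumFinEquiv
        (fun l => UnitaryGroup.toLocalRing E v (z₁ (e₂ n₁ (Sum.inl l))) + UnitaryGroup.toLocalRing E v (z₁ (e₂ n₁ (Sum.inr l))) * algebraMap E (LocalRing E v) δ)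
        (fun l => UnitaryGroup.toLocalRing E v (z₂ (e₂ n₂ (Sum.inl l))) + UnitaryGroup.toLocalRing E v (z₂ (e₂ n₂ (Sum.inr l))) * algebraMap E (LocalRing E v) δ)) := by
  funext s
  rcases s with m | m <;> obtain ⟨s', rfl⟩ := finSumFinEquiv.surjective m <;> rcases s' with l | l <;>
    rw [K2LiuTensorMiddleCellPointReading.eD_symm_apply] <;>
    simp only [adblV, Sum.elim_inl, Sum.elim_inr, Pi.neg_apply, ← blkIdx_inl_inl, ← blkIdx_inl_inr, ← blkIdx_inr_inl, ← blkIdx_inr_inr,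
      glue_apply_inl, glue_apply_inr, Function.comp_apply, Equiv.symm_apply_apply, map_neg, neg_mul, neg_add]

/-- **`ι(g)⁻¹ (e_D u) = e_D (matA g⁻¹ · u)`** (★ `eD_matA_mulVec` read backwards: `matA g · matA g⁻¹ = 1`). [cite: Kudla1994, §3] -/
theorem coe_iotaD_symm_eD (n : ℕ) {T₀ : Matrix (Fin n) (Fin n) F} (hT₀ : T₀.IsSymm) {JD : Matrix (Fin (n + n)) (Fin (n + n)) E}
    (hJD : JD = (gramD F n T₀).map (algebraMap F E)) (g : UnitaryGroup.localPi E c (n + n) JD v) (u : Fin n ⊕ Fin n → LocalRing E v) :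
    ((iotaD F E c hcδ hδ hd v n hT₀ hJD g : LocalSp F (n + n) (gramD F n T₀) v) :
        ((Fin (n + n) → v.adicCompletion F) × (Fin (n + n) → v.adicCompletion F)) ≃ₗ[v.adicCompletion F]
          ((Fin (n + n) → v.adicCompletion F) × (Fin (n + n) → v.adicCompletion F))).symm (eD F E c hcδ hδ hd v n u) =
      eD F E c hcδ hδ hd v n (matA F E c v n g⁻¹ *ᵥ u) := by
  rw [LinearEquiv.symm_apply_eq]
  have h := eD_matA_mulVec F E c hcδ hδ hd v n hT₀ hJD g (matA F E c v n g⁻¹ *ᵥ u)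
  rw [Matrix.mulVec_mulVec, matA_mul, mul_inv_cancel, matA_one, Matrix.one_mulVec] at h
  exact h

end Generic

section Tensor

variable (L : Type) [Field L] [NumberField L] [IsCMField L]
variable {N M : ℕ} (e : Fin N × Fin M ≃ Fin 2)
  (dV : Fin N → L) (hdV : ∀ i, IsCMField.complexConj L (dV i) = dV i)
  (dW : Fin M → L) (hdW : ∀ i, IsCMField.complexConj L (dW i) = dW i)
variable {M₂ M' : ℕ} (eW : Fin M × Fin M₂ ≃ Fin M') (e' : Fin N × Fin M' ≃ Fin (M₂ + M₂))
  (dV' : Fin M₂ → L) (hdV' : ∀ k, IsCMField.complexConj L (dV' k) = dV' k)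
  (v : HeightOneSpectrum (𝓞 (Fp L)))

/-- **`(p₀ ⊗ 1)⁻¹` ON ANTI-DIAGONAL VECTORS**: for a small Siegel–Levi `p₀` (`B(p₀) = 0`, `D(p₀) · G = 1`),
`matA (p₀ ⊗ 1)⁻¹ · adblV b = adblV (reindex epsV (G ⊗ₖ 1) · b)` (★ F5c-A `matA_tensorEmbLoc` + `blk_reindex_kronecker`, ★ `mulVec_adblV`, §0).
[cite: Kudla1994, §3] [cite: MoeglinVignerasWaldspurger1987, Chap. 2 II.6] -/
theorem matA_tensorEmbLoc_inv_mulVec_adblV (p₀ : UnitaryGroup.localPi L (IsCMField.complexConj L) (2 + 2) (hermD L e dV hdV dW hdW) v)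
    (hB0 : blkB (matA (Fp L) L (IsCMField.complexConj L) v 2 p₀) = 0) (G : Matrix (Fin 2) (Fin 2) (LocalRing L v))
    (hG : blkD (matA (Fp L) L (IsCMField.complexConj L) v 2 p₀) * G = 1) (b : Fin (M₂ + M₂) → LocalRing L v) :
    matA (Fp L) L (IsCMField.complexConj L) v (M₂ + M₂) (tensorEmbLoc L e dV hdV dW hdW eW e' dV' hdV' v p₀)⁻¹ *ᵥ adblV b =
      adblV (Matrix.reindex (epsV e eW e') (epsV e eW e') (G ⊗ₖ (1 : Matrix (Fin M₂) (Fin M₂) (LocalRing L v))) *ᵥ b) := by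
  obtain ⟨hBi, hDi⟩ := blkB_blkD_matA_inv (Fp L) L (IsCMField.complexConj L) v 2 hB0 hG
  obtain ⟨-, hB', -, hD'⟩ := blk_reindex_kronecker (epsV e eW e') (matA (Fp L) L (IsCMField.complexConj L) v 2 p₀⁻¹)
    (1 : Matrix (Fin M₂) (Fin M₂) (LocalRing L v))
  rw [← map_inv, matA_tensorEmbLoc, mulVec_adblV, hB', hD', hBi, hDi, Matrix.zero_kronecker, Matrix.reindex_apply, Matrix.submatrix_zero,
    Pi.zero_apply, Pi.zero_apply, Matrix.zero_mulVec, dblV_zero, zero_add]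

/-! ## §2 The two-block point through `E′⁻¹` (any implementer pair) -/

set_option maxHeartbeats 800000 in -- as ★ (C3-c) `toLin_inv_frameMp_boxLoc_apply`: `isDefEq` on the `MpPsi (localSchrodinger …)` ∕ `frameMp` letters
/-- **THE TWO-BLOCK POINT THROUGH `E′⁻¹`** (★ (C3-c) `toLin_inv_frameMp_boxLoc_apply` with both blocks): for `E′ = π(frameMp_{PD} j̃(p₁, p₂)) =
frameW_{PD} ∘ (π(p₁) ⊞ π(p₂)) ∘ frameW_{PD}⁻¹`, `E′⁻¹ (P̂D (z₁ ⊔ z₂), 0) = frameW_{PD} (u₁.1 ⊔ u₂.1, u₁.2 ⊔ u₂.2)` with `uᵢ = π(pᵢ)⁻¹ (zᵢ, 0)`.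
[cite: MoeglinVignerasWaldspurger1987, Chap. 2 II.1 Rem. (6)] [cite: Kudla1994, §2] -/
theorem symm_apply_frameLin_glue {T₁ T₂ : Matrix (Fin M₂) (Fin M₂) (Fp L)} (P : GL (Fin (M₂ + M₂)) (Fp L))
    (hP : ((P : Matrix (Fin (M₂ + M₂)) (Fin (M₂ + M₂)) (Fp L)))ᵀ *
        gramR L e' dV hdV (tensorFrame L dW eW dV') (tensorFrame_real L dW hdW eW dV' hdV') * (P : Matrix _ _ (Fp L)) =
      UnitaryGroup.finSum M₂ M₂ T₁ T₂)
    {PD : GL (Fin ((M₂ + M₂) + (M₂ + M₂))) (Fp L)} (hPD : PD = UnitaryGroup.reindexGL (e₂ (M₂ + M₂)) (UnitaryGroup.blockDiagGL (P, P)))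
    (p₁ : LocalMp (Fp L) (M₂ + M₂) (gramD (Fp L) M₂ T₁) v) (p₂ : LocalMp (Fp L) (M₂ + M₂) (gramD (Fp L) M₂ T₂) v)
    (z₁ z₂ : Fin (M₂ + M₂) → v.adicCompletion (Fp L)) :
    ((MpPsi.proj _ (frameMp (Fp L) v ((M₂ + M₂) + (M₂ + M₂)) PD (transpose_pd_mul_gramD_mul_pd (Fp L) (M₂ + M₂) P hP hPD)
        (boxLoc (Fp L) v M₂ M₂ (T₁ := T₁) (T₂ := T₂) (p₁, p₂))) :
          LocalSp (Fp L) ((M₂ + M₂) + (M₂ + M₂))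
            (gramD (Fp L) (M₂ + M₂) (gramR L e' dV hdV (tensorFrame L dW eW dV') (tensorFrame_real L dW hdW eW dV' hdV'))) v) :
        ((Fin ((M₂ + M₂) + (M₂ + M₂)) → v.adicCompletion (Fp L)) × (Fin ((M₂ + M₂) + (M₂ + M₂)) → v.adicCompletion (Fp L))) ≃ₗ[v.adicCompletion (Fp L)]
          ((Fin ((M₂ + M₂) + (M₂ + M₂)) → v.adicCompletion (Fp L)) × (Fin ((M₂ + M₂) + (M₂ + M₂)) → v.adicCompletion (Fp L)))).symm
      (frameLin (Fp L) v ((M₂ + M₂) + (M₂ + M₂)) PD (glue (blkIdx M₂ M₂) z₁ z₂), 0) =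
    frameW (Fp L) v ((M₂ + M₂) + (M₂ + M₂)) PD
      (glue (blkIdx M₂ M₂)
          (((MpPsi.proj _ p₁ : LocalSp (Fp L) (M₂ + M₂) (gramD (Fp L) M₂ T₁) v) :
              ((Fin (M₂ + M₂) → v.adicCompletion (Fp L)) × (Fin (M₂ + M₂) → v.adicCompletion (Fp L))) ≃ₗ[v.adicCompletion (Fp L)]
                ((Fin (M₂ + M₂) → v.adicCompletion (Fp L)) × (Fin (M₂ + M₂) → v.adicCompletion (Fp L)))).symm (z₁, 0)).1
          (((MpPsi.proj _ p₂ : LocalSp (Fp L) (M₂ + M₂) (gramD (Fp L) M₂ T₂) v) :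
              ((Fin (M₂ + M₂) → v.adicCompletion (Fp L)) × (Fin (M₂ + M₂) → v.adicCompletion (Fp L))) ≃ₗ[v.adicCompletion (Fp L)]
                ((Fin (M₂ + M₂) → v.adicCompletion (Fp L)) × (Fin (M₂ + M₂) → v.adicCompletion (Fp L)))).symm (z₂, 0)).1,
        glue (blkIdx M₂ M₂)
          (((MpPsi.proj _ p₁ : LocalSp (Fp L) (M₂ + M₂) (gramD (Fp L) M₂ T₁) v) :
              ((Fin (M₂ + M₂) → v.adicCompletion (Fp L)) × (Fin (M₂ + M₂) → v.adicCompletion (Fp L))) ≃ₗ[v.adicCompletion (Fp L)]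
                ((Fin (M₂ + M₂) → v.adicCompletion (Fp L)) × (Fin (M₂ + M₂) → v.adicCompletion (Fp L)))).symm (z₁, 0)).2
          (((MpPsi.proj _ p₂ : LocalSp (Fp L) (M₂ + M₂) (gramD (Fp L) M₂ T₂) v) :
              ((Fin (M₂ + M₂) → v.adicCompletion (Fp L)) × (Fin (M₂ + M₂) → v.adicCompletion (Fp L))) ≃ₗ[v.adicCompletion (Fp L)]
                ((Fin (M₂ + M₂) → v.adicCompletion (Fp L)) × (Fin (M₂ + M₂) → v.adicCompletion (Fp L)))).symm (z₂, 0)).2) := by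
  rw [LinearEquiv.symm_apply_eq]
  -- `π(frameMp_{PD} j̃) = frameSp_{PD} (spInl π(p₁) · spInr π(p₂))` (★ rfl lemmas; `simp`, not `rw`: reducible matching on the `LocalMp` letters)
  simp only [proj_frameMp, proj_boxLoc, frameSp, symplecticConj_apply, LinearEquiv.symm_apply_apply]
  -- `(π(p₁) ⊞ π(p₂)) (u₁.1 ⊔ u₂.1, u₁.2 ⊔ u₂.2) = (z₁ ⊔ z₂, 0 ⊔ 0)` and `frameW_{PD} (z₁ ⊔ z₂, 0) = (P̂D (z₁ ⊔ z₂), 0)`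
  simp only [Subgroup.coe_mul, LinearEquiv.mul_apply, coe_spInl, coe_spInr, inrW_apply_glue, inlW_apply_glue, Prod.mk.eta,
    LinearEquiv.apply_symm_apply, glue_zero, frameW_apply, map_zero]

/-! ## §3 At the NORMALISED implementer pair: the `E ⊗ F_v`-coordinates of the two-block point, and the slot action of `G ⊗ 1` -/

section Normalised

variable {σ : Equiv.Perm (Fin (M₂ + M₂))} {T₁ T₂ : Matrix (Fin M₂) (Fin M₂) (Fp L)}
  (P : GL (Fin (M₂ + M₂)) (Fp L)) (hPσ : (P : Matrix (Fin (M₂ + M₂)) (Fin (M₂ + M₂)) (Fp L)) = σ.toPEquiv.toMatrix)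
  (hP : ((P : Matrix (Fin (M₂ + M₂)) (Fin (M₂ + M₂)) (Fp L)))ᵀ *
      gramR L e' dV hdV (tensorFrame L dW eW dV') (tensorFrame_real L dW hdW eW dV' hdV') * (P : Matrix _ _ (Fp L)) =
    UnitaryGroup.finSum M₂ M₂ T₁ T₂)
  {PD : GL (Fin ((M₂ + M₂) + (M₂ + M₂))) (Fp L)} (hPD : PD = UnitaryGroup.reindexGL (e₂ (M₂ + M₂)) (UnitaryGroup.blockDiagGL (P, P)))
  -- the NORMALISED implementer pair of record (★ B′: `π(p̂ᵢ) = transportSp 𝕋ᵢ (m(Qᵢ)·κᵢ)`, `κᵢ` the Cayley matrix along `e₂ ⊕ e₂`, `Qᵢ⁻¹ = 2 ⊕ Tᵢ` along `e₂`)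
  (hTv₁ : IsUnit (localGram (Fp L) (M₂ + M₂) (gramD (Fp L) M₂ T₁) v).det)
  (K₁ : Matrix.symplecticGroup (Fin (M₂ + M₂)) (v.adicCompletion (Fp L)))
  (hK₁ : (K₁ : Matrix (Fin (M₂ + M₂) ⊕ Fin (M₂ + M₂)) (Fin (M₂ + M₂) ⊕ Fin (M₂ + M₂)) (v.adicCompletion (Fp L))) =
    Matrix.reindex ((e₂ M₂).sumCongr (e₂ M₂)) ((e₂ M₂).sumCongr (e₂ M₂))
      (Matrix.fromBlocks (Matrix.fromBlocks 1 (-1) 0 0)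
          (Matrix.fromBlocks 0 0 ((⅟(2 : v.adicCompletion (Fp L))) • 1) ((⅟(2 : v.adicCompletion (Fp L))) • 1))
          (Matrix.fromBlocks 0 0 (-1) (-1))
          (Matrix.fromBlocks ((⅟(2 : v.adicCompletion (Fp L))) • 1) (-((⅟(2 : v.adicCompletion (Fp L))) • 1)) 0 0) :
        Matrix ((Fin M₂ ⊕ Fin M₂) ⊕ (Fin M₂ ⊕ Fin M₂)) ((Fin M₂ ⊕ Fin M₂) ⊕ (Fin M₂ ⊕ Fin M₂)) (v.adicCompletion (Fp L))))
  (Q₁ : GL (Fin (M₂ + M₂)) (v.adicCompletion (Fp L)))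
  (hQ₁ : ((Q₁⁻¹ : GL (Fin (M₂ + M₂)) (v.adicCompletion (Fp L))) : Matrix (Fin (M₂ + M₂)) (Fin (M₂ + M₂)) (v.adicCompletion (Fp L))) =
    Matrix.reindex (e₂ M₂) (e₂ M₂) (Matrix.fromBlocks ((2 : v.adicCompletion (Fp L)) • 1) 0 0 (localGram (Fp L) M₂ T₁ v)))
  (p₁ : LocalMp (Fp L) (M₂ + M₂) (gramD (Fp L) M₂ T₁) v)
  (hp₁ : MpPsi.proj _ p₁ = transportSp (localGram (Fp L) (M₂ + M₂) (gramD (Fp L) M₂ T₁) v) hTv₁ (levi Q₁ * K₁))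
  (hTv₂ : IsUnit (localGram (Fp L) (M₂ + M₂) (gramD (Fp L) M₂ T₂) v).det)
  (K₂ : Matrix.symplecticGroup (Fin (M₂ + M₂)) (v.adicCompletion (Fp L)))
  (hK₂ : (K₂ : Matrix (Fin (M₂ + M₂) ⊕ Fin (M₂ + M₂)) (Fin (M₂ + M₂) ⊕ Fin (M₂ + M₂)) (v.adicCompletion (Fp L))) =
    Matrix.reindex ((e₂ M₂).sumCongr (e₂ M₂)) ((e₂ M₂).sumCongr (e₂ M₂))
      (Matrix.fromBlocks (Matrix.fromBlocks 1 (-1) 0 0)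
          (Matrix.fromBlocks 0 0 ((⅟(2 : v.adicCompletion (Fp L))) • 1) ((⅟(2 : v.adicCompletion (Fp L))) • 1))
          (Matrix.fromBlocks 0 0 (-1) (-1))
          (Matrix.fromBlocks ((⅟(2 : v.adicCompletion (Fp L))) • 1) (-((⅟(2 : v.adicCompletion (Fp L))) • 1)) 0 0) :
        Matrix ((Fin M₂ ⊕ Fin M₂) ⊕ (Fin M₂ ⊕ Fin M₂)) ((Fin M₂ ⊕ Fin M₂) ⊕ (Fin M₂ ⊕ Fin M₂)) (v.adicCompletion (Fp L))))
  (Q₂ : GL (Fin (M₂ + M₂)) (v.adicCompletion (Fp L)))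
  (hQ₂ : ((Q₂⁻¹ : GL (Fin (M₂ + M₂)) (v.adicCompletion (Fp L))) : Matrix (Fin (M₂ + M₂)) (Fin (M₂ + M₂)) (v.adicCompletion (Fp L))) =
    Matrix.reindex (e₂ M₂) (e₂ M₂) (Matrix.fromBlocks ((2 : v.adicCompletion (Fp L)) • 1) 0 0 (localGram (Fp L) M₂ T₂ v)))
  (p₂ : LocalMp (Fp L) (M₂ + M₂) (gramD (Fp L) M₂ T₂) v)
  (hp₂ : MpPsi.proj _ p₂ = transportSp (localGram (Fp L) (M₂ + M₂) (gramD (Fp L) M₂ T₂) v) hTv₂ (levi Q₂ * K₂))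

set_option maxHeartbeats 800000 in -- as §2 ∕ ★ (C3-c): the `MpPsi (localSchrodinger …)` ∕ `frameMp` letters in the rewrites
include hPσ hK₁ hQ₁ hp₁ hK₂ hQ₂ hp₂ in
/-- **THE TWO-BLOCK POINT IN `E ⊗ F_v`-COORDINATES, AT THE NORMALISED PAIR**: `E′⁻¹ (P̂D (z₁ ⊔ z₂), 0) = e_D (adblV ((Z z₁ ⊔ Z z₂) ∘ σ))` with the PLAIN
quadratic coordinates `Z z l = ι z_{e₂(inl l)} + ι z_{e₂(inr l)} · δ̂` (★ B′: `π(p̂ᵢ)⁻¹ (z, 0) = ((z¹ ⊔ −z¹), (z² ⊔ −z²))`; §2; §1; `P = σ.toPEquiv.toMatrix`).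
[cite: Kudla1994, §2, §3 Thm. 3.1] [cite: HarrisKudlaSweet1996, §1 (1.11)] [cite: MoeglinVignerasWaldspurger1987, Chap. 2 II.1 Rem. (6), II.2] -/
theorem symm_apply_frameLin_glue_eq_eD_adblV (z₁ z₂ : Fin (M₂ + M₂) → v.adicCompletion (Fp L)) :
    ((MpPsi.proj _ (frameMp (Fp L) v ((M₂ + M₂) + (M₂ + M₂)) PD (transpose_pd_mul_gramD_mul_pd (Fp L) (M₂ + M₂) P hP hPD)
        (boxLoc (Fp L) v M₂ M₂ (T₁ := T₁) (T₂ := T₂) (p₁, p₂))) :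
          LocalSp (Fp L) ((M₂ + M₂) + (M₂ + M₂))
            (gramD (Fp L) (M₂ + M₂) (gramR L e' dV hdV (tensorFrame L dW eW dV') (tensorFrame_real L dW hdW eW dV' hdV'))) v) :
        ((Fin ((M₂ + M₂) + (M₂ + M₂)) → v.adicCompletion (Fp L)) × (Fin ((M₂ + M₂) + (M₂ + M₂)) → v.adicCompletion (Fp L))) ≃ₗ[v.adicCompletion (Fp L)]
          ((Fin ((M₂ + M₂) + (M₂ + M₂)) → v.adicCompletion (Fp L)) × (Fin ((M₂ + M₂) + (M₂ + M₂)) → v.adicCompletion (Fp L)))).symm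
      (frameLin (Fp L) v ((M₂ + M₂) + (M₂ + M₂)) PD (glue (blkIdx M₂ M₂) z₁ z₂), 0) =
    eD (Fp L) L (IsCMField.complexConj L) (complexConj_imagUnit L) (imagUnit_ne_zero L) (imagUnit_mul_self L) v (M₂ + M₂)
      (adblV ((glue finSumFinEquiv
        (fun l => UnitaryGroup.toLocalRing L v (z₁ (e₂ M₂ (Sum.inl l))) +
          UnitaryGroup.toLocalRing L v (z₁ (e₂ M₂ (Sum.inr l))) * algebraMap L (LocalRing L v) (imagUnit L))
        (fun l => UnitaryGroup.toLocalRing L v (z₂ (e₂ M₂ (Sum.inl l))) +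
          UnitaryGroup.toLocalRing L v (z₂ (e₂ M₂ (Sum.inr l))) * algebraMap L (LocalRing L v) (imagUnit L))) ∘ σ)) := by
  haveI : Algebra.IsQuadraticExtension (Fp L) L := IsCMField.isQuadraticExtension L
  refine (LinearEquiv.symm_apply_eq _).1 ?_
  rw [symm_apply_frameLin_glue L dV hdV dW hdW eW e' dV' hdV' v P hP hPD p₁ p₂ z₁ z₂, hp₁, hp₂,
    K2LiuNormalisedCayleyReading.transportSp_levi_mul_cayley_symm_apply (Fp L) v M₂ hTv₁ K₁ hK₁ Q₁ hQ₁ z₁,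
    K2LiuNormalisedCayleyReading.transportSp_levi_mul_cayley_symm_apply (Fp L) v M₂ hTv₂ K₂ hK₂ Q₂ hQ₂ z₂,
    eD_symm_frameW_pd (Fp L) L (IsCMField.complexConj L) (complexConj_imagUnit L) (imagUnit_ne_zero L) (imagUnit_mul_self L) v (M₂ + M₂) P hPD]
  dsimp only
  rw [eD_symm_glue_antidiag (Fp L) L (IsCMField.complexConj L) (complexConj_imagUnit L) (imagUnit_ne_zero L) (imagUnit_mul_self L) v M₂ M₂ z₁ z₂,
    fromBlocks_diag_mulVec_adblV, hPσ, PEquiv.map_toMatrix, PEquiv.toMatrix_toPEquiv_mulVec]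

variable {i₀ i₁ : Fin 2} (hi : i₀ ≠ i₁)
  (hσ₀ : ∀ k, σ (epsV e eW e' (i₀, k)) = finSumFinEquiv (Sum.inl k)) (hσ₁ : ∀ k, σ (epsV e eW e' (i₁, k)) = finSumFinEquiv (Sum.inr k))

include hi hσ₀ hσ₁ in
/-- **THE FIRST-COLUMN ACTION OF `G ⊗ 1` ON THE ONE-BLOCK POINT** (★ p865058 `reindex_kronecker_one_mulVec_slot` through the block permutation `σ`): the
coordinates `(Z x₁ ⊔ Z 0) ∘ σ` are supported on the `𝕍`-slot `i₀`, so `reindex epsV (G ⊗ₖ 1)` sends them to `(Z y₁ ⊔ Z y₂) ∘ σ` whenever `Z y₁ = G i₀ i₀ · Z x₁` and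
`Z y₂ = G i₁ i₀ · Z x₁`. [cite: Kudla1994, §3 Thm. 3.1] [cite: HarrisKudlaSweet1996, §1 (1.11)–(1.12)] -/
theorem reindex_kronecker_one_mulVec_glue_comp (G : Matrix (Fin 2) (Fin 2) (LocalRing L v)) (x₁ y₁ y₂ : Fin (M₂ + M₂) → v.adicCompletion (Fp L))
    (hy₁ : ∀ l : Fin M₂, UnitaryGroup.toLocalRing L v (y₁ (e₂ M₂ (Sum.inl l))) +
        UnitaryGroup.toLocalRing L v (y₁ (e₂ M₂ (Sum.inr l))) * algebraMap L (LocalRing L v) (imagUnit L) =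
      G i₀ i₀ * (UnitaryGroup.toLocalRing L v (x₁ (e₂ M₂ (Sum.inl l))) +
        UnitaryGroup.toLocalRing L v (x₁ (e₂ M₂ (Sum.inr l))) * algebraMap L (LocalRing L v) (imagUnit L)))
    (hy₂ : ∀ l : Fin M₂, UnitaryGroup.toLocalRing L v (y₂ (e₂ M₂ (Sum.inl l))) +
        UnitaryGroup.toLocalRing L v (y₂ (e₂ M₂ (Sum.inr l))) * algebraMap L (LocalRing L v) (imagUnit L) =
      G i₁ i₀ * (UnitaryGroup.toLocalRing L v (x₁ (e₂ M₂ (Sum.inl l))) +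
        UnitaryGroup.toLocalRing L v (x₁ (e₂ M₂ (Sum.inr l))) * algebraMap L (LocalRing L v) (imagUnit L))) :
    Matrix.reindex (epsV e eW e') (epsV e eW e') (G ⊗ₖ (1 : Matrix (Fin M₂) (Fin M₂) (LocalRing L v))) *ᵥ
        ((glue finSumFinEquiv
          (fun l => UnitaryGroup.toLocalRing L v (x₁ (e₂ M₂ (Sum.inl l))) +
            UnitaryGroup.toLocalRing L v (x₁ (e₂ M₂ (Sum.inr l))) * algebraMap L (LocalRing L v) (imagUnit L))
          (fun l => UnitaryGroup.toLocalRing L v ((0 : Fin (M₂ + M₂) → v.adicCompletion (Fp L)) (e₂ M₂ (Sum.inl l))) +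
            UnitaryGroup.toLocalRing L v ((0 : Fin (M₂ + M₂) → v.adicCompletion (Fp L)) (e₂ M₂ (Sum.inr l))) *
              algebraMap L (LocalRing L v) (imagUnit L))) ∘ σ) =
      (glue finSumFinEquiv
        (fun l => UnitaryGroup.toLocalRing L v (y₁ (e₂ M₂ (Sum.inl l))) +
          UnitaryGroup.toLocalRing L v (y₁ (e₂ M₂ (Sum.inr l))) * algebraMap L (LocalRing L v) (imagUnit L))
        (fun l => UnitaryGroup.toLocalRing L v (y₂ (e₂ M₂ (Sum.inl l))) +
          UnitaryGroup.toLocalRing L v (y₂ (e₂ M₂ (Sum.inr l))) * algebraMap L (LocalRing L v) (imagUnit L))) ∘ σ := by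
  -- the one-block coordinates are supported on slot `i₀`
  have hy : ∀ (a : Fin 2) (l : Fin M₂),
      ((glue finSumFinEquiv
          (fun l => UnitaryGroup.toLocalRing L v (x₁ (e₂ M₂ (Sum.inl l))) +
            UnitaryGroup.toLocalRing L v (x₁ (e₂ M₂ (Sum.inr l))) * algebraMap L (LocalRing L v) (imagUnit L))
          (fun l => UnitaryGroup.toLocalRing L v ((0 : Fin (M₂ + M₂) → v.adicCompletion (Fp L)) (e₂ M₂ (Sum.inl l))) +
            UnitaryGroup.toLocalRing L v ((0 : Fin (M₂ + M₂) → v.adicCompletion (Fp L)) (e₂ M₂ (Sum.inr l))) *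
              algebraMap L (LocalRing L v) (imagUnit L))) ∘ σ) (epsV e eW e' (a, l)) =
        if a = i₀ then UnitaryGroup.toLocalRing L v (x₁ (e₂ M₂ (Sum.inl l))) +
          UnitaryGroup.toLocalRing L v (x₁ (e₂ M₂ (Sum.inr l))) * algebraMap L (LocalRing L v) (imagUnit L) else 0 := by
    intro a l
    rw [Function.comp_apply]
    by_cases ha : a = i₀
    · rw [if_pos ha, ha, hσ₀, glue_apply_inl]
    · have ha1 : a = i₁ := by omega
      rw [if_neg ha, ha1, hσ₁, glue_apply_inr, Pi.zero_apply, Pi.zero_apply, map_zero, zero_mul, add_zero]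
  funext k
  obtain ⟨⟨a, l⟩, rfl⟩ := (epsV e eW e').surjective k
  rw [K2LiuQuadraticCoordinateBlockAction.reindex_kronecker_one_mulVec_slot (epsV e eW e') G i₀ _ _ hy a l, Function.comp_apply]
  by_cases ha : a = i₀
  · rw [ha, hσ₀, glue_apply_inl, hy₁]
  · have ha1 : a = i₁ := by omega
    rw [ha1, hσ₁, glue_apply_inr, hy₂]

end Normalised

end Tensor

end Summit.HodgeConjecture.HodgeConjecture.Cruxes.HLiu418.K2LiuConeGraphReadingPointCoords

end
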